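/-
Copyright (c) 2026 the pub-hodgecm-mathlib formalisation cell (harness21).  Prover seat hodgecm-mathlib-K2E1-p09 (g6), Track B ∕ K2-LIT, h413 =
`stmt-HodgeConjecture-24833`, ENGINE E1, campaign «EIS-R7-BL-SPH-2», deal «BL-P3 FILE C» of the dealer K2E1-plan (g5) (ORDER 2026-09-04T09:18:31Z (a): the `𝔛`-side operator).
-/
import Summits.HodgeConjecture.HodgeConjecture.Theorems.K2E1BLShiftBoundU2     -- ★ (this seat) P3 FILE A ∕ B1 ∕ B2: height comparison, `lintegral_mul_sq_le`, the `Z`-side operator; brings the BL leaves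
import Literature.NumberTheory.Automorphic.UnitaryGroupKernelDictionary          -- ★ `quotientSubgroup_quasiSplit` (`A_G = 1`: `quotientSubgroup = arithmeticSubgroup`)
import HarnessLib

/-!
# K2·E1 — `K2E1BLHeckeOperatorHXU2` («EIS-R7-BL-SPH-2», P3 FILE C, part 1): BERNSTEIN–LAPID'S `R(h)` ON `𝓗_k(𝔛) = L²(𝔛; w₁^{−2k}μ)` — THE WEIGHT `w₁` UNDER A COMPACT SET,
# AND THE TONELLI `L²`-ESTIMATE `∫_𝔛 w₁^{−2k}‖R(h)u‖² dμ ≤ κ^{2k}‖h‖₁²·∫_𝔛 w₁^{−2k}‖u‖² dμ` (rank-generic, no letters beyond `IsAutomorphicMeasure`-type invariance)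

Track B ∕ K2-LIT, crux h413 = `stmt-HodgeConjecture-24833`, route of record `HCCMUnconditional`; cell `hodgecm-mathlib`, squad K2, ENGINE E1 (campaign «EIS-R7-BL», (ζ′) WIRING
7d1cceb628a30de8 §3 P3 «`δ(h) := R(h)` is bounded on `𝓗_k(𝔛)`»; dealer 09:18:31Z (a) «`exists_shiftOperatorX`: `T_X : HX k μ →L HX k μ`, `T_X u =ᵐ R(h)u`, `‖T_X‖ ≤ κ^k‖h‖₁` — same
Tonelli with `w₁(x·y) ≍_Ω w₁(x)`, `μ` right-`G(𝔸)`-invariant = `IsAutomorphicMeasure`»).  Prover seat `hodgecm-mathlib-K2E1-p09` (g6).  THEOREMS ONLY (no `def`, no `instance`, no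
notation, no named-fact hypothesis, no `sorry`; default heartbeats); lane `--supports stmt-HodgeConjecture-24833 --as helper` (count-neutral).  Closes no socket.  RANK-GENERIC.

THE MATHEMATICS [BernsteinLapid2019, §4 p. 10; MoeglinWaldspurger1995, I.2.13; Folland1999, Thm. 2.37, Thm. 6.18].  On `𝔛 = G(𝔸)∕G(F)` (the tree's ★ `automorphicQuotient`, LEFT
`G(𝔸)`-action `y • [g] = [y·g]`, functions by ★ `quotFun φ [g] = φ(g⁻¹)`) right translation of automorphic functions reads `(R_y φ)^𝔛(ξ) = φ^𝔛(y⁻¹ • ξ)`, so Bernstein–Lapid's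
`R(h)` is  `(R(h)u)(ξ) = ∫_{G(𝔸)} h(y)·u(y⁻¹ • ξ) dν(y)`  (and `p : Z → 𝔛` intertwines: `p(z·y) = y⁻¹ • p(z)`, part 2).  The weight `w₁([g]) = ⨆_{γ ∈ G(F)} H(γ·g⁻¹)` (★ D5
`supHeight`, §1: representative-free, lower semicontinuous, measurable, positive — the rank-`N` twins of ★ P2a-ι `K2E1BLIotaBoundU2` §1) satisfies, for `Ω ⊆ G(𝔸)` compact and the
`κ_Ω` of ★ FILE A, **`w₁(y⁻¹•ξ) ≤ κ·w₁(ξ)` and `w₁(ξ) ≤ κ·w₁(y⁻¹•ξ)` (`y ∈ Ω`)** (§2: `w₁(y⁻¹•[g]) = ⨆_γ H(γ·g⁻¹·y)` and ★ FILE A §3).  Hence, EXACTLY as on `Z` (★ B1) but with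
NO truncation and NO letter (`ξ ↦ y⁻¹•ξ` preserves every `SMulInvariantMeasure`, in particular every `IsAutomorphicMeasure`): for `h` measurable, `∫⁻‖h‖ₑ < ∞`, `= 0` off `Ω`, and
`u : 𝔛 → ℂ` measurable,
  **`∫⁻ W·‖R(h)u‖ₑ² dμ ≤ κ^{2k}·(∫⁻‖h‖ₑ)²·∫⁻ W·‖u‖ₑ² dμ`**, `W = w₁^{−2k}` (§4, Tonelli on `𝔛 × G(𝔸)` — `(ξ, y) ↦ y⁻¹•ξ` is jointly continuous, §3),
and (§5) the null-set transfer along `(ξ, y) ↦ y⁻¹•ξ`: `R(h)` respects `μ`-a.e. equality, and `y ↦ h(y)u(y⁻¹•ξ)` is integrable for a.e. `ξ` when `∫⁻ W‖u‖ₑ² < ∞`.  Part 2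
(`K2E1BLHeckeOperatorHXU2Op`) assembles `T_X : 𝓗_k(𝔛) →L 𝓗_k(𝔛)` and proves the intertwining `δ(h) ∘ ι = restr ∘ ι ∘ T_X` with ★ `deltaShift` ∕ ★ `iota`.

* §1 (★ `quotientSubgroup_quasiSplit`) `ciSup_borelHeight_arith_mul_mul_right` (`G(F)`-reindexing), **`supHeight_toAutomorphicQuotient`** (`w₁[g] = ⨆_γ H(γ g⁻¹)`), `supHeight_pos`, `isOpen_setOf_lt_supHeight`,
  `measurable_supHeight`, `measurable_weightX`.
* §2 **`exists_supHeight_inv_smul_le_of_isCompact`** (two-sided, `κ ≥ 1`), `weightX_le_mul_weightX`.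
* §3 `continuous_inv_smul_uncurry`, `measurable_inv_smul_uncurry`, `measurable_integrandX`.
* §4 `weightX_mul_enorm_sq_conv_le` (pointwise), `lintegral_comp_inv_smul_eq` (invariance), **`lintegral_weightX_mul_enorm_sq_conv_le`** (THE BOUND).
* §5 **`ae_ae_comp_inv_smul`** (null-set transfer), **`convX_congr_ae`**, **`ae_integrable_mul_comp_inv_smul`**.
HONEST LABEL: HC_CM is proved only modulo the 7 printed citations (2 remaining named inputs: hLiu418 = `stmt-HodgeConjecture-24832`, h413 = `stmt-HodgeConjecture-24833`) until rung 0
closes; this file asserts no named fact and closes no socket; count-neutral.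

## References
* [BernsteinLapid2019] J. Bernstein, E. Lapid, *On the meromorphic continuation of Eisenstein series*, J. Amer. Math. Soc. 37 (2024) (arXiv:1911.02342): §4 p. 10.
* [MoeglinWaldspurger1995] C. Mœglin, J.-L. Waldspurger, *Spectral Decomposition and Eisenstein Series* (1995): I.2.13.
* [Folland1999] G. B. Folland, *Real Analysis* (2nd ed., 1999): Thm. 2.37 (Tonelli), Thm. 6.18.
-/

set_option autoImplicit false
set_option linter.dupNamespace false  -- the mandated namespace repeats the summit's segment (`HodgeConjecture.HodgeConjecture`)

noncomputable section

open MeasureTheory NumberField IsDedekindDomain Filter Topology Set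
open scoped NNReal ENNReal
open Literature.NumberTheory.Automorphic Literature.NumberTheory.Automorphic.UnitaryGroup AdelicGroupData
open Summit.HodgeConjecture.HodgeConjecture.Cruxes.H413.K2E1BLBorelSpacesU2Defs
open Summit.HodgeConjecture.HodgeConjecture.Cruxes.H413.K2E1BLHeckeOperatorWeightedU2
open Summit.HodgeConjecture.HodgeConjecture.Cruxes.H413.K2E1BLRightConvTonelliU2 (lintegral_mul_sq_le enorm_mul_le_add_sq)

namespace Summit.HodgeConjecture.HodgeConjecture.Cruxes.H413.K2E1BLHeckeOperatorHXU2

variable {F E : Type} [Field F] [NumberField F] [Field E] [NumberField E] [Algebra F E] {c : E ≃ₐ[F] E} {N : ℕ} [NeZero N]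

/-! ## §1 The weight `w₁` on `𝔛`: representative-free, positive, lower semicontinuous, measurable (rank `N`) -/

/-- **`w₁` is `G(F)`-invariant on the right of the index**: `⨆_γ H(γ·(γ₁·x)) = ⨆_γ H(γ·x)` for `γ₁ ∈ G(F)` (re-index `γ ↦ γ·γ₁`). [cite: BernsteinLapid2019, §4 p. 10] -/
theorem ciSup_borelHeight_arith_mul_mul_right (γ₁ : (quasiSplit F E c N).arithmeticSubgroup) (x : (quasiSplit F E c N).Adelic) :
    (⨆ γ : (quasiSplit F E c N).arithmeticSubgroup, borelHeight ((γ : (quasiSplit F E c N).Adelic) * ((γ₁ : (quasiSplit F E c N).Adelic) * x))) =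
      ⨆ γ : (quasiSplit F E c N).arithmeticSubgroup, borelHeight ((γ : (quasiSplit F E c N).Adelic) * x) := by
  have h : (fun γ : (quasiSplit F E c N).arithmeticSubgroup => borelHeight ((γ : (quasiSplit F E c N).Adelic) * ((γ₁ : (quasiSplit F E c N).Adelic) * x))) =
      (fun γ : (quasiSplit F E c N).arithmeticSubgroup => borelHeight ((γ : (quasiSplit F E c N).Adelic) * x)) ∘ (fun γ => γ * γ₁) := by
    funext γ
    simp only [Function.comp_apply, Subgroup.coe_mul, mul_assoc]
  rw [h]
  exact (Equiv.mulRight γ₁).surjective.iSup_comp (fun γ : (quasiSplit F E c N).arithmeticSubgroup => borelHeight ((γ : (quasiSplit F E c N).Adelic) * x))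

/-- **`w₁[g] = ⨆_{γ ∈ G(F)} H(γ·g⁻¹)`** — representative-free (`[g].out = g·γ'`, `γ' ∈ quotientSubgroup = G(F)`, and §1 invariance); rank-`N` twin of ★ P2a-ι
`K2E1BLIotaBoundU2.supHeight_toAutomorphicQuotient`. [cite: BernsteinLapid2019, §4 p. 10] -/
theorem supHeight_toAutomorphicQuotient (g : (quasiSplit F E c N).Adelic) :
    supHeight F E c N ((quasiSplit F E c N).toAutomorphicQuotient g) = ⨆ γ : (quasiSplit F E c N).arithmeticSubgroup, borelHeight ((γ : (quasiSplit F E c N).Adelic) * g⁻¹) := by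
  -- re-index D5's supremum over `Rational` to the arithmetic subgroup (surjective `rangeRestrict`, pattern of ★ P7-C `supHeight_eq_ciSup_arithmetic`)
  have hsurj : Function.Surjective ((quasiSplit F E c N).toAdelic.rangeRestrict : (quasiSplit F E c N).Rational → (quasiSplit F E c N).arithmeticSubgroup) :=
    MonoidHom.rangeRestrict_surjective _
  have hreidx : supHeight F E c N ((quasiSplit F E c N).toAutomorphicQuotient g) = ⨆ γ' : (quasiSplit F E c N).arithmeticSubgroup,
      borelHeight ((γ' : (quasiSplit F E c N).Adelic) * (Quotient.out ((quasiSplit F E c N).toAutomorphicQuotient g : (quasiSplit F E c N).Adelic ⧸ (quasiSplit F E c N).quotientSubgroup))⁻¹) := by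
    unfold K2E1BLBorelSpacesU2Defs.supHeight
    exact hsurj.iSup_comp (fun γ' : (quasiSplit F E c N).arithmeticSubgroup =>
      borelHeight ((γ' : (quasiSplit F E c N).Adelic) * (Quotient.out ((quasiSplit F E c N).toAutomorphicQuotient g : (quasiSplit F E c N).Adelic ⧸ (quasiSplit F E c N).quotientSubgroup))⁻¹))
  rw [hreidx]
  obtain ⟨q, hq⟩ := QuotientGroup.mk_out_eq_mul (quasiSplit F E c N).quotientSubgroup g
  have hq' : Quotient.out ((quasiSplit F E c N).toAutomorphicQuotient g : (quasiSplit F E c N).Adelic ⧸ (quasiSplit F E c N).quotientSubgroup) =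
      g * (q : (quasiSplit F E c N).Adelic) := hq
  have hmem : ((q : (quasiSplit F E c N).Adelic))⁻¹ ∈ (quasiSplit F E c N).arithmeticSubgroup := by
    rw [← quotientSubgroup_quasiSplit]
    exact inv_mem q.2
  rw [hq', _root_.mul_inv_rev]
  exact ciSup_borelHeight_arith_mul_mul_right ⟨_, hmem⟩ g⁻¹

/-- **`0 < w₁(ξ)`** (`H(g⁻¹) ≤ w₁[g]`, heights are positive). [cite: BernsteinLapid2019, §4 p. 10] -/
theorem supHeight_pos (ξ : (quasiSplit F E c N).automorphicQuotient) : 0 < supHeight F E c N ξ := by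
  induction ξ using QuotientGroup.induction_on with
  | H g =>
    change 0 < supHeight F E c N ((quasiSplit F E c N).toAutomorphicQuotient g)
    rw [supHeight_toAutomorphicQuotient]
    have h1 := le_ciSup (bddAbove_range_borelHeight_arith_mul g⁻¹) (1 : (quasiSplit F E c N).arithmeticSubgroup)
    rw [OneMemClass.coe_one, one_mul] at h1
    exact lt_of_lt_of_le (borelHeight_pos g⁻¹) h1

/-- **`w₁` IS LOWER SEMICONTINUOUS**: `{ξ ∣ a < w₁ ξ}` is open (the image under the open map `G(𝔸) → 𝔛` of `⋃_γ {g ∣ a < H(γ g⁻¹)}`); rank-`N` twin of ★ P2a-ι. [cite: BernsteinLapid2019, §4 p. 10] -/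
theorem isOpen_setOf_lt_supHeight (a : ℝ≥0) : IsOpen {ξ : (quasiSplit F E c N).automorphicQuotient | a < supHeight F E c N ξ} := by
  set U : Set (quasiSplit F E c N).Adelic := {g | ∃ γ : (quasiSplit F E c N).arithmeticSubgroup, a < borelHeight ((γ : (quasiSplit F E c N).Adelic) * g⁻¹)} with hU
  have hUo : IsOpen U := by
    have hU' : U = ⋃ γ : (quasiSplit F E c N).arithmeticSubgroup, {g | a < borelHeight ((γ : (quasiSplit F E c N).Adelic) * g⁻¹)} := by
      ext g; simp only [hU, Set.mem_setOf_eq, Set.mem_iUnion]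
    rw [hU']
    exact isOpen_iUnion fun γ => isOpen_lt continuous_const (continuous_borelHeight.comp ((continuous_const_mul _).comp continuous_inv))
  have heq : {ξ : (quasiSplit F E c N).automorphicQuotient | a < supHeight F E c N ξ} = (quasiSplit F E c N).toAutomorphicQuotient '' U := by
    ext ξ
    constructor
    · intro hξ
      induction ξ using QuotientGroup.induction_on with
      | H g =>
        refine ⟨g, ?_, rfl⟩
        have hg : a < supHeight F E c N ((quasiSplit F E c N).toAutomorphicQuotient g) := hξ
        rw [supHeight_toAutomorphicQuotient] at hg
        exact (lt_ciSup_iff (bddAbove_range_borelHeight_arith_mul _)).1 hg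
    · rintro ⟨g, ⟨γ, hγ⟩, rfl⟩
      show a < supHeight F E c N ((quasiSplit F E c N).toAutomorphicQuotient g)
      rw [supHeight_toAutomorphicQuotient]
      exact lt_of_lt_of_le hγ (le_ciSup (bddAbove_range_borelHeight_arith_mul g⁻¹) γ)
  rw [heq]
  exact QuotientGroup.isOpenMap_coe U hUo

/-- **`w₁` is Borel measurable.** [cite: BernsteinLapid2019, §4 p. 10] -/
theorem measurable_supHeight : Measurable (supHeight F E c N) :=
  measurable_of_Ioi fun a => (isOpen_setOf_lt_supHeight a).measurableSet

/-- The weight `ξ ↦ w₁(ξ)^{−2k}` (in `ℝ≥0∞`) is measurable. [cite: BernsteinLapid2019, §4 p. 10] -/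
theorem measurable_weightX (k : ℕ) : Measurable fun ξ : (quasiSplit F E c N).automorphicQuotient => ((((supHeight F E c N ξ)⁻¹ ^ (2 * k) : ℝ≥0)) : ℝ≥0∞) :=
  ((measurable_supHeight.inv).pow_const _).coe_nnreal_ennreal

/-! ## §2 `w₁` under a compact set: `w₁(y⁻¹•ξ) ≍ w₁(ξ)` -/

/-- `w₁(y⁻¹ • [g]) = ⨆_γ H(γ·(g⁻¹·y))` (`y⁻¹ • [g] = [y⁻¹g]`, `(y⁻¹g)⁻¹ = g⁻¹y`). [cite: BernsteinLapid2019, §4 p. 10] -/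
theorem supHeight_inv_smul_toAutomorphicQuotient (y g : (quasiSplit F E c N).Adelic) :
    supHeight F E c N (y⁻¹ • (quasiSplit F E c N).toAutomorphicQuotient g) = ⨆ γ : (quasiSplit F E c N).arithmeticSubgroup, borelHeight ((γ : (quasiSplit F E c N).Adelic) * (g⁻¹ * y)) := by
  rw [show y⁻¹ • (quasiSplit F E c N).toAutomorphicQuotient g = (quasiSplit F E c N).toAutomorphicQuotient (y⁻¹ * g) from rfl, supHeight_toAutomorphicQuotient, _root_.mul_inv_rev, inv_inv]

/-- **`w₁(y⁻¹•ξ) ≤ κ·w₁(ξ)` AND `w₁(ξ) ≤ κ·w₁(y⁻¹•ξ)` for `y ∈ Ω` compact** (★ FILE A `exists_ciSup_borelHeight_mul_le_of_isCompact` at `x = g⁻¹`). [cite: BernsteinLapid2019, §4 p. 10] -/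
theorem exists_supHeight_inv_smul_le_of_isCompact {Ω : Set (quasiSplit F E c N).Adelic} (hΩ : IsCompact Ω) :
    ∃ κ : ℝ≥0, 1 ≤ κ ∧ ∀ ξ : (quasiSplit F E c N).automorphicQuotient, ∀ y ∈ Ω,
      supHeight F E c N (y⁻¹ • ξ) ≤ κ * supHeight F E c N ξ ∧ supHeight F E c N ξ ≤ κ * supHeight F E c N (y⁻¹ • ξ) := by
  obtain ⟨κ, hκ1, hκ⟩ := exists_ciSup_borelHeight_mul_le_of_isCompact hΩ
  refine ⟨κ, hκ1, fun ξ y hy => ?_⟩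
  induction ξ using QuotientGroup.induction_on with
  | H g =>
    change supHeight F E c N (y⁻¹ • (quasiSplit F E c N).toAutomorphicQuotient g) ≤ κ * supHeight F E c N ((quasiSplit F E c N).toAutomorphicQuotient g) ∧
      supHeight F E c N ((quasiSplit F E c N).toAutomorphicQuotient g) ≤ κ * supHeight F E c N (y⁻¹ • (quasiSplit F E c N).toAutomorphicQuotient g)
    rw [supHeight_inv_smul_toAutomorphicQuotient, supHeight_toAutomorphicQuotient]
    exact hκ g⁻¹ y hy

/-- **THE WEIGHT COMPARISON IN `ℝ≥0∞`**: `w₁(η) ≤ κ·w₁(ξ)` gives `w₁(ξ)^{−2k} ≤ κ^{2k}·w₁(η)^{−2k}`. [cite: BernsteinLapid2019, §4 p. 10] -/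
theorem weightX_le_mul_weightX {κ : ℝ≥0} (k : ℕ) {ξ η : (quasiSplit F E c N).automorphicQuotient} (hle : supHeight F E c N η ≤ κ * supHeight F E c N ξ) :
    ((((supHeight F E c N ξ)⁻¹ ^ (2 * k) : ℝ≥0)) : ℝ≥0∞) ≤ ((κ ^ (2 * k) : ℝ≥0) : ℝ≥0∞) * (((supHeight F E c N η)⁻¹ ^ (2 * k) : ℝ≥0) : ℝ≥0∞) := by
  have hξ := supHeight_pos ξ
  have hη := supHeight_pos η
  have h1 : (supHeight F E c N ξ)⁻¹ ≤ κ * (supHeight F E c N η)⁻¹ := by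
    rw [← div_eq_mul_inv, le_div_iff₀ hη, inv_mul_le_iff₀ hξ, mul_comm]
    exact hle
  have h2 : (supHeight F E c N ξ)⁻¹ ^ (2 * k) ≤ κ ^ (2 * k) * (supHeight F E c N η)⁻¹ ^ (2 * k) := by
    rw [← mul_pow]; exact pow_le_pow_left₀ zero_le h1 _
  exact_mod_cast h2

/-! ## §3 Joint measurability of `(ξ, y) ↦ y⁻¹•ξ` and of the Tonelli integrand -/

section Measurable

variable [MeasurableSpace (quasiSplit F E c N).Adelic] [BorelSpace (quasiSplit F E c N).Adelic]

omit [NeZero N] [MeasurableSpace (quasiSplit F E c N).Adelic] [BorelSpace (quasiSplit F E c N).Adelic] in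
/-- `(ξ, y) ↦ y⁻¹ • ξ` is continuous on `𝔛 × G(𝔸)` (★ `instContinuousSMulAutomorphicQuotient`). [folklore] -/
theorem continuous_inv_smul_uncurry : Continuous fun p : (quasiSplit F E c N).automorphicQuotient × (quasiSplit F E c N).Adelic => p.2⁻¹ • p.1 :=
  (continuous_snd.inv).smul continuous_fst

omit [NeZero N] in
/-- `(ξ, y) ↦ y⁻¹ • ξ` is measurable for the product of the Borel σ-algebras (`G(𝔸)` second countable ★). [folklore] -/
theorem measurable_inv_smul_uncurry : Measurable fun p : (quasiSplit F E c N).automorphicQuotient × (quasiSplit F E c N).Adelic => p.2⁻¹ • p.1 := by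
  haveI := secondCountableTopology_quasiSplitAdelic (F := F) (E := E) (c := c) (N := N)
  exact (continuous_inv_smul_uncurry (F := F) (E := E) (c := c) (N := N)).measurable

omit [NeZero N] in
/-- `y ↦ y⁻¹ • ξ` is measurable. [folklore] -/
theorem measurable_inv_smul_left (ξ : (quasiSplit F E c N).automorphicQuotient) : Measurable fun y : (quasiSplit F E c N).Adelic => y⁻¹ • ξ :=
  ((continuous_inv).smul continuous_const).measurable

/-- The integrand `(ξ, y) ↦ ‖h y‖ₑ·W(y⁻¹•ξ)·‖u(y⁻¹•ξ)‖ₑ²` is measurable on `𝔛 × G(𝔸)`. [folklore] -/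
theorem measurable_integrandX {h : (quasiSplit F E c N).Adelic → ℂ} (hhm : Measurable h) (k : ℕ) {u : (quasiSplit F E c N).automorphicQuotient → ℂ} (hu : Measurable u) :
    Measurable fun p : (quasiSplit F E c N).automorphicQuotient × (quasiSplit F E c N).Adelic =>
      ‖h p.2‖ₑ * (((((supHeight F E c N (p.2⁻¹ • p.1))⁻¹ ^ (2 * k) : ℝ≥0)) : ℝ≥0∞) * ‖u (p.2⁻¹ • p.1)‖ₑ ^ 2) :=
  (hhm.comp measurable_snd).enorm.mul (((measurable_weightX k).comp measurable_inv_smul_uncurry).mul ((hu.comp measurable_inv_smul_uncurry).enorm.pow_const 2))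

end Measurable

/-! ## §4 The `L²`-estimate on `𝔛` in `∫⁻` form -/

section Tonelli

variable [MeasurableSpace (quasiSplit F E c N).Adelic] [BorelSpace (quasiSplit F E c N).Adelic]
  (νG : Measure (quasiSplit F E c N).Adelic) (μ : Measure (quasiSplit F E c N).automorphicQuotient)

/-- **THE POINTWISE `∫⁻` ESTIMATE**: for `κ` with `w₁(y⁻¹•ξ) ≤ κ·w₁(ξ)` on `Ω`, `h` measurable and `= 0` off `Ω`, `u` measurable, and every `ξ`:
`W(ξ)·‖∫ h(y)u(y⁻¹•ξ) dν‖ₑ² ≤ κ^{2k}·(∫⁻‖h‖ₑ)·∫⁻ ‖h(y)‖ₑ·(W(y⁻¹•ξ)·‖u(y⁻¹•ξ)‖ₑ²) dν`. [cite: BernsteinLapid2019, §4 p. 10] [cite: Folland1999, Thm. 6.18] -/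
theorem weightX_mul_enorm_sq_conv_le {Ω : Set (quasiSplit F E c N).Adelic} {κ : ℝ≥0}
    (hΩ : ∀ ξ : (quasiSplit F E c N).automorphicQuotient, ∀ y ∈ Ω, supHeight F E c N (y⁻¹ • ξ) ≤ κ * supHeight F E c N ξ)
    {h : (quasiSplit F E c N).Adelic → ℂ} (hhm : Measurable h) (hsupp : ∀ y, y ∉ Ω → h y = 0) (k : ℕ) {u : (quasiSplit F E c N).automorphicQuotient → ℂ} (hu : Measurable u)
    (ξ : (quasiSplit F E c N).automorphicQuotient) :
    ((((supHeight F E c N ξ)⁻¹ ^ (2 * k) : ℝ≥0)) : ℝ≥0∞) * ‖∫ y, h y * u (y⁻¹ • ξ) ∂νG‖ₑ ^ 2 ≤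
      ((κ ^ (2 * k) : ℝ≥0) : ℝ≥0∞) * (∫⁻ y, ‖h y‖ₑ ∂νG) *
        ∫⁻ y, ‖h y‖ₑ * (((((supHeight F E c N (y⁻¹ • ξ))⁻¹ ^ (2 * k) : ℝ≥0)) : ℝ≥0∞) * ‖u (y⁻¹ • ξ)‖ₑ ^ 2) ∂νG := by
  have huξ : Measurable fun y => u (y⁻¹ • ξ) := hu.comp (measurable_inv_smul_left ξ)
  have h1 : ‖∫ y, h y * u (y⁻¹ • ξ) ∂νG‖ₑ ≤ ∫⁻ y, ‖h y‖ₑ * ‖u (y⁻¹ • ξ)‖ₑ ∂νG := by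
    refine (enorm_integral_le_lintegral_enorm _).trans (le_of_eq (lintegral_congr fun y => ?_))
    rw [enorm_mul]
  have h2 : ‖∫ y, h y * u (y⁻¹ • ξ) ∂νG‖ₑ ^ 2 ≤ (∫⁻ y, ‖h y‖ₑ ∂νG) * ∫⁻ y, ‖h y‖ₑ * ‖u (y⁻¹ • ξ)‖ₑ ^ 2 ∂νG :=
    (pow_le_pow_left₀ zero_le h1 2).trans (lintegral_mul_sq_le νG hhm.enorm.aemeasurable huξ.enorm.aemeasurable)
  have h3 : ∀ y, ((((supHeight F E c N ξ)⁻¹ ^ (2 * k) : ℝ≥0)) : ℝ≥0∞) * (‖h y‖ₑ * ‖u (y⁻¹ • ξ)‖ₑ ^ 2) ≤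
      ((κ ^ (2 * k) : ℝ≥0) : ℝ≥0∞) * (‖h y‖ₑ * (((((supHeight F E c N (y⁻¹ • ξ))⁻¹ ^ (2 * k) : ℝ≥0)) : ℝ≥0∞) * ‖u (y⁻¹ • ξ)‖ₑ ^ 2)) := by
    intro y
    by_cases hy : y ∈ Ω
    · calc _ ≤ (((κ ^ (2 * k) : ℝ≥0) : ℝ≥0∞) * ((((supHeight F E c N (y⁻¹ • ξ))⁻¹ ^ (2 * k) : ℝ≥0)) : ℝ≥0∞)) * (‖h y‖ₑ * ‖u (y⁻¹ • ξ)‖ₑ ^ 2) :=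
            mul_le_mul_left (weightX_le_mul_weightX k (hΩ ξ y hy)) _
        _ = _ := by ring
    · rw [hsupp y hy, enorm_zero, zero_mul, zero_mul, mul_zero, mul_zero]
  calc ((((supHeight F E c N ξ)⁻¹ ^ (2 * k) : ℝ≥0)) : ℝ≥0∞) * ‖∫ y, h y * u (y⁻¹ • ξ) ∂νG‖ₑ ^ 2
      ≤ ((((supHeight F E c N ξ)⁻¹ ^ (2 * k) : ℝ≥0)) : ℝ≥0∞) * ((∫⁻ y, ‖h y‖ₑ ∂νG) * ∫⁻ y, ‖h y‖ₑ * ‖u (y⁻¹ • ξ)‖ₑ ^ 2 ∂νG) := mul_le_mul_right h2 _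
    _ = (∫⁻ y, ‖h y‖ₑ ∂νG) * ∫⁻ y, ((((supHeight F E c N ξ)⁻¹ ^ (2 * k) : ℝ≥0)) : ℝ≥0∞) * (‖h y‖ₑ * ‖u (y⁻¹ • ξ)‖ₑ ^ 2) ∂νG := by
        rw [lintegral_const_mul' _ _ ENNReal.coe_ne_top]; ring
    _ ≤ (∫⁻ y, ‖h y‖ₑ ∂νG) * ∫⁻ y, ((κ ^ (2 * k) : ℝ≥0) : ℝ≥0∞) * (‖h y‖ₑ * (((((supHeight F E c N (y⁻¹ • ξ))⁻¹ ^ (2 * k) : ℝ≥0)) : ℝ≥0∞) * ‖u (y⁻¹ • ξ)‖ₑ ^ 2)) ∂νG :=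
        mul_le_mul_right (lintegral_mono h3) _
    _ = _ := by rw [lintegral_const_mul' _ _ ENNReal.coe_ne_top]; ring

variable [SMulInvariantMeasure (quasiSplit F E c N).Adelic (quasiSplit F E c N).automorphicQuotient μ]

omit [NeZero N] [MeasurableSpace (quasiSplit F E c N).Adelic] [BorelSpace (quasiSplit F E c N).Adelic] in
/-- **INVARIANCE**: `∫⁻ Φ(y⁻¹•ξ) dμ(ξ) = ∫⁻ Φ dμ` for measurable `Φ ≥ 0` (`ξ ↦ y⁻¹•ξ` preserves every `SMulInvariantMeasure`, Mathlib `measurePreserving_smul`). [folklore] -/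
theorem lintegral_comp_inv_smul_eq (y : (quasiSplit F E c N).Adelic) {Φ : (quasiSplit F E c N).automorphicQuotient → ℝ≥0∞} (hΦ : Measurable Φ) :
    ∫⁻ ξ, Φ (y⁻¹ • ξ) ∂μ = ∫⁻ ξ, Φ ξ ∂μ :=
  (measurePreserving_smul y⁻¹ μ).lintegral_comp hΦ

/-- **THE `L²`-BOUND ON `𝔛` IN `∫⁻` FORM**: for `μ` invariant (`SMulInvariantMeasure` — every ★ `IsAutomorphicMeasure`) and s-finite, `νG` s-finite, the two-sided comparison of `w₁` on
`Ω` by `κ`, `h` measurable with `∫⁻‖h‖ₑ < ∞` and `= 0` off `Ω`, `u` measurable: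
`∫⁻ W·‖R(h)u‖ₑ² dμ ≤ κ^{2k}·(∫⁻‖h‖ₑ)²·∫⁻ W·‖u‖ₑ² dμ` (Tonelli on `𝔛 × G(𝔸)`; NO letter). [cite: BernsteinLapid2019, §4 p. 10] [cite: Folland1999, Thm. 2.37] -/
theorem lintegral_weightX_mul_enorm_sq_conv_le [SFinite νG] [SFinite μ] {Ω : Set (quasiSplit F E c N).Adelic} {κ : ℝ≥0}
    (hΩ : ∀ ξ : (quasiSplit F E c N).automorphicQuotient, ∀ y ∈ Ω, supHeight F E c N (y⁻¹ • ξ) ≤ κ * supHeight F E c N ξ ∧ supHeight F E c N ξ ≤ κ * supHeight F E c N (y⁻¹ • ξ))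
    {h : (quasiSplit F E c N).Adelic → ℂ} (hhm : Measurable h) (hh1 : ∫⁻ y, ‖h y‖ₑ ∂νG ≠ ∞) (hsupp : ∀ y, y ∉ Ω → h y = 0) (k : ℕ)
    {u : (quasiSplit F E c N).automorphicQuotient → ℂ} (hu : Measurable u) :
    ∫⁻ ξ, ((((supHeight F E c N ξ)⁻¹ ^ (2 * k) : ℝ≥0)) : ℝ≥0∞) * ‖∫ y, h y * u (y⁻¹ • ξ) ∂νG‖ₑ ^ 2 ∂μ ≤
      ((κ ^ (2 * k) : ℝ≥0) : ℝ≥0∞) * (∫⁻ y, ‖h y‖ₑ ∂νG) ^ 2 * ∫⁻ ξ, ((((supHeight F E c N ξ)⁻¹ ^ (2 * k) : ℝ≥0)) : ℝ≥0∞) * ‖u ξ‖ₑ ^ 2 ∂μ := by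
  set A := ∫⁻ y, ‖h y‖ₑ ∂νG with hA
  set C := ∫⁻ ξ, ((((supHeight F E c N ξ)⁻¹ ^ (2 * k) : ℝ≥0)) : ℝ≥0∞) * ‖u ξ‖ₑ ^ 2 ∂μ with hC
  have hI := measurable_integrandX hhm k hu
  have h1 : ∫⁻ ξ, ((((supHeight F E c N ξ)⁻¹ ^ (2 * k) : ℝ≥0)) : ℝ≥0∞) * ‖∫ y, h y * u (y⁻¹ • ξ) ∂νG‖ₑ ^ 2 ∂μ ≤
      ((κ ^ (2 * k) : ℝ≥0) : ℝ≥0∞) * A * ∫⁻ ξ, ∫⁻ y, ‖h y‖ₑ * (((((supHeight F E c N (y⁻¹ • ξ))⁻¹ ^ (2 * k) : ℝ≥0)) : ℝ≥0∞) * ‖u (y⁻¹ • ξ)‖ₑ ^ 2) ∂νG ∂μ := by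
    rw [← lintegral_const_mul' _ _ (ENNReal.mul_ne_top ENNReal.coe_ne_top hh1)]
    exact lintegral_mono fun ξ => weightX_mul_enorm_sq_conv_le νG (fun ξ y hy => (hΩ ξ y hy).1) hhm hsupp k hu ξ
  have h2 : ∫⁻ ξ, ∫⁻ y, ‖h y‖ₑ * (((((supHeight F E c N (y⁻¹ • ξ))⁻¹ ^ (2 * k) : ℝ≥0)) : ℝ≥0∞) * ‖u (y⁻¹ • ξ)‖ₑ ^ 2) ∂νG ∂μ =
      ∫⁻ y, ∫⁻ ξ, ‖h y‖ₑ * (((((supHeight F E c N (y⁻¹ • ξ))⁻¹ ^ (2 * k) : ℝ≥0)) : ℝ≥0∞) * ‖u (y⁻¹ • ξ)‖ₑ ^ 2) ∂μ ∂νG :=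
    lintegral_lintegral_swap hI.aemeasurable
  have h3 : ∀ y, ∫⁻ ξ, ‖h y‖ₑ * (((((supHeight F E c N (y⁻¹ • ξ))⁻¹ ^ (2 * k) : ℝ≥0)) : ℝ≥0∞) * ‖u (y⁻¹ • ξ)‖ₑ ^ 2) ∂μ = ‖h y‖ₑ * C := by
    intro y
    rw [lintegral_const_mul' _ _ enorm_ne_top, lintegral_comp_inv_smul_eq μ y (Φ := fun ξ => ((((supHeight F E c N ξ)⁻¹ ^ (2 * k) : ℝ≥0)) : ℝ≥0∞) * ‖u ξ‖ₑ ^ 2)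
      ((measurable_weightX k).mul (hu.enorm.pow_const 2))]
  calc _ ≤ ((κ ^ (2 * k) : ℝ≥0) : ℝ≥0∞) * A * ∫⁻ y, ∫⁻ ξ, ‖h y‖ₑ * (((((supHeight F E c N (y⁻¹ • ξ))⁻¹ ^ (2 * k) : ℝ≥0)) : ℝ≥0∞) * ‖u (y⁻¹ • ξ)‖ₑ ^ 2) ∂μ ∂νG := by
        rw [← h2]; exact h1
    _ = ((κ ^ (2 * k) : ℝ≥0) : ℝ≥0∞) * A * ∫⁻ y, ‖h y‖ₑ * C ∂νG := by rw [lintegral_congr h3]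
    _ = ((κ ^ (2 * k) : ℝ≥0) : ℝ≥0∞) * A ^ 2 * C := by rw [lintegral_mul_const _ hhm.enorm, hA]; ring

/-! ## §5 The null-set transfer along `(ξ, y) ↦ y⁻¹•ξ`; a.e.-congruence; a.e. integrability -/

omit [NeZero N] in
/-- **THE NULL-SET TRANSFER ON `𝔛`**: if `p` holds `μ`-a.e., then for `μ`-a.e. `ξ` it holds at `y⁻¹•ξ` for `νG`-a.e. `y` (Tonelli on the indicator of `{(ξ, y) : y⁻¹•ξ ∈ T}`, each
`y`-slice being `(y⁻¹•·)⁻¹ T`, `μ`-null by invariance). [cite: Folland1999, Thm. 2.37] -/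
theorem ae_ae_comp_inv_smul [SFinite νG] [SFinite μ] {p : (quasiSplit F E c N).automorphicQuotient → Prop} (hp : ∀ᵐ ξ ∂μ, p ξ) :
    ∀ᵐ ξ ∂μ, ∀ᵐ y ∂νG, p (y⁻¹ • ξ) := by
  obtain ⟨T, hTsub, hTm, hT0⟩ := exists_measurable_superset_of_null (ae_iff.1 hp)
  set A : Set ((quasiSplit F E c N).automorphicQuotient × (quasiSplit F E c N).Adelic) := {q | q.2⁻¹ • q.1 ∈ T} with hAdef
  have hAm : MeasurableSet A := hTm.preimage measurable_inv_smul_uncurry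
  have hA0 : (μ.prod νG) A = 0 := by
    rw [Measure.prod_apply_symm hAm]
    refine (lintegral_congr fun y => ?_).trans lintegral_zero
    change μ ((fun ξ => (ξ, y)) ⁻¹' A) = 0
    have hpre : (fun ξ : (quasiSplit F E c N).automorphicQuotient => (ξ, y)) ⁻¹' A = (fun ξ => y⁻¹ • ξ) ⁻¹' T := rfl
    rw [hpre, (measurePreserving_smul y⁻¹ μ).measure_preimage hTm.nullMeasurableSet, hT0]
  have hae : ∀ᵐ q ∂(μ.prod νG), q ∉ A := ae_iff.2 (by simpa only [not_not, Set.setOf_mem_eq] using hA0)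
  filter_upwards [Measure.ae_ae_of_ae_prod hae] with ξ hξ
  filter_upwards [hξ] with y hy
  by_contra hpy
  exact hy (hTsub hpy)

omit [NeZero N] in
/-- **`R(h)` RESPECTS a.e.-EQUALITY ON `𝔛`**: `u₁ =ᵐ[μ] u₂ ⟹ R(h)u₁ =ᵐ[μ] R(h)u₂` (no integrability needed). [cite: BernsteinLapid2019, §4 p. 10] -/
theorem convX_congr_ae [SFinite νG] [SFinite μ] (h : (quasiSplit F E c N).Adelic → ℂ) {u₁ u₂ : (quasiSplit F E c N).automorphicQuotient → ℂ} (h12 : u₁ =ᵐ[μ] u₂) :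
    (fun ξ => ∫ y, h y * u₁ (y⁻¹ • ξ) ∂νG) =ᵐ[μ] fun ξ => ∫ y, h y * u₂ (y⁻¹ • ξ) ∂νG := by
  filter_upwards [ae_ae_comp_inv_smul νG μ (p := fun ξ => u₁ ξ = u₂ ξ) h12] with ξ hξ
  exact integral_congr_ae (hξ.mono fun y hy => by change h y * u₁ (y⁻¹ • ξ) = h y * u₂ (y⁻¹ • ξ); rw [hy])

/-- **a.e. INTEGRABILITY OF THE INTEGRAND**: `h` measurable, integrable, `= 0` off `Ω` (two-sided comparison by `κ`), `u` measurable with `∫⁻ W‖u‖ₑ² dμ < ∞` ⟹ for `μ`-a.e. `ξ`,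
`y ↦ h(y)·u(y⁻¹•ξ)` is `νG`-integrable. [cite: Folland1999, Thm. 2.37] -/
theorem ae_integrable_mul_comp_inv_smul [SFinite νG] [SFinite μ] {Ω : Set (quasiSplit F E c N).Adelic} {κ : ℝ≥0}
    (hΩ : ∀ ξ : (quasiSplit F E c N).automorphicQuotient, ∀ y ∈ Ω, supHeight F E c N (y⁻¹ • ξ) ≤ κ * supHeight F E c N ξ ∧ supHeight F E c N ξ ≤ κ * supHeight F E c N (y⁻¹ • ξ))
    {h : (quasiSplit F E c N).Adelic → ℂ} (hhm : Measurable h) (hh : Integrable h νG) (hsupp : ∀ y, y ∉ Ω → h y = 0) (k : ℕ)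
    {u : (quasiSplit F E c N).automorphicQuotient → ℂ} (hu : Measurable u) (hfin : ∫⁻ ξ, ((((supHeight F E c N ξ)⁻¹ ^ (2 * k) : ℝ≥0)) : ℝ≥0∞) * ‖u ξ‖ₑ ^ 2 ∂μ ≠ ∞) :
    ∀ᵐ ξ ∂μ, Integrable (fun y => h y * u (y⁻¹ • ξ)) νG := by
  have hI := measurable_integrandX hhm k hu
  have hfinite : ∫⁻ ξ, ∫⁻ y, ‖h y‖ₑ * (((((supHeight F E c N (y⁻¹ • ξ))⁻¹ ^ (2 * k) : ℝ≥0)) : ℝ≥0∞) * ‖u (y⁻¹ • ξ)‖ₑ ^ 2) ∂νG ∂μ ≠ ∞ := by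
    rw [lintegral_lintegral_swap hI.aemeasurable]
    have h3 : ∀ y, ∫⁻ ξ, ‖h y‖ₑ * (((((supHeight F E c N (y⁻¹ • ξ))⁻¹ ^ (2 * k) : ℝ≥0)) : ℝ≥0∞) * ‖u (y⁻¹ • ξ)‖ₑ ^ 2) ∂μ =
        ‖h y‖ₑ * ∫⁻ ξ, ((((supHeight F E c N ξ)⁻¹ ^ (2 * k) : ℝ≥0)) : ℝ≥0∞) * ‖u ξ‖ₑ ^ 2 ∂μ := by
      intro y
      rw [lintegral_const_mul' _ _ enorm_ne_top, lintegral_comp_inv_smul_eq μ y (Φ := fun ξ => ((((supHeight F E c N ξ)⁻¹ ^ (2 * k) : ℝ≥0)) : ℝ≥0∞) * ‖u ξ‖ₑ ^ 2)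
        ((measurable_weightX k).mul (hu.enorm.pow_const 2))]
    rw [lintegral_congr h3, lintegral_mul_const _ hhm.enorm]
    exact ENNReal.mul_ne_top hh.2.ne hfin
  filter_upwards [ae_lt_top (hI.lintegral_prod_right') hfinite] with ξ hξ
  have huξ : Measurable fun y => u (y⁻¹ • ξ) := hu.comp (measurable_inv_smul_left ξ)
  have hWξ : ((((supHeight F E c N ξ)⁻¹ ^ (2 * k) : ℝ≥0)) : ℝ≥0∞) ≠ 0 := by
    exact_mod_cast (pow_pos (inv_pos.2 (supHeight_pos ξ)) _).ne'
  have hsq : ∫⁻ y, ‖h y‖ₑ * ‖u (y⁻¹ • ξ)‖ₑ ^ 2 ∂νG < ∞ := by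
    have hle : ∀ y, ((((supHeight F E c N ξ)⁻¹ ^ (2 * k) : ℝ≥0)) : ℝ≥0∞) * (‖h y‖ₑ * ‖u (y⁻¹ • ξ)‖ₑ ^ 2) ≤
        ((κ ^ (2 * k) : ℝ≥0) : ℝ≥0∞) * (‖h y‖ₑ * (((((supHeight F E c N (y⁻¹ • ξ))⁻¹ ^ (2 * k) : ℝ≥0)) : ℝ≥0∞) * ‖u (y⁻¹ • ξ)‖ₑ ^ 2)) := by
      intro y
      by_cases hy : y ∈ Ω
      · calc _ ≤ (((κ ^ (2 * k) : ℝ≥0) : ℝ≥0∞) * ((((supHeight F E c N (y⁻¹ • ξ))⁻¹ ^ (2 * k) : ℝ≥0)) : ℝ≥0∞)) * (‖h y‖ₑ * ‖u (y⁻¹ • ξ)‖ₑ ^ 2) :=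
              mul_le_mul_left (weightX_le_mul_weightX k (hΩ ξ y hy).1) _
          _ = _ := by ring
      · rw [hsupp y hy, enorm_zero, zero_mul, zero_mul, mul_zero, mul_zero]
    have hbound : ((((supHeight F E c N ξ)⁻¹ ^ (2 * k) : ℝ≥0)) : ℝ≥0∞) * ∫⁻ y, ‖h y‖ₑ * ‖u (y⁻¹ • ξ)‖ₑ ^ 2 ∂νG < ∞ := by
      rw [← lintegral_const_mul' _ _ ENNReal.coe_ne_top]
      refine lt_of_le_of_lt (lintegral_mono hle) ?_
      rw [lintegral_const_mul' _ _ ENNReal.coe_ne_top]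
      exact ENNReal.mul_lt_top ENNReal.coe_lt_top hξ
    exact (ENNReal.mul_lt_top_iff.1 hbound).elim (fun h' => h'.2) fun h' => h'.elim (fun h0 => (hWξ h0).elim) fun hb0 => by rw [hb0]; exact ENNReal.zero_lt_top
  refine ⟨(hhm.mul huξ).aestronglyMeasurable, ?_⟩
  refine lt_of_le_of_lt (lintegral_mono fun y => ?_) (show ∫⁻ y, ‖h y‖ₑ + ‖h y‖ₑ * ‖u (y⁻¹ • ξ)‖ₑ ^ 2 ∂νG < ∞ from ?_)
  · rw [enorm_mul]; exact enorm_mul_le_add_sq _ _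
  · rw [lintegral_add_left hhm.enorm]
    exact ENNReal.add_lt_top.2 ⟨hh.2, hsq⟩

end Tonelli

end Summit.HodgeConjecture.HodgeConjecture.Cruxes.H413.K2E1BLHeckeOperatorHXU2

end
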